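/-
Copyright: the b2b-balaban T⁴-continuum CRUX team, row NE7b leaf lineage `t4-ne7b-formalise-leaf-04` (gen 146). Project licence.
-/
import Summits.QuantumFields.BalabanUV.T4Continuum.Spine.NE7b.ConvexTiltMomentPiFree
import Summits.QuantumFields.BalabanUV.T4Continuum.Spine.NE7b.CarrierOnSupport

/-!
# `LocCondStability` BY NAME for the CONVEXITY-ROAD carrier IN PRODUCT COORDINATES, DATA `(S, σ, P, dP, h; q, u)` ONLY:
# `M = ∫e^{−(xᵀSx + P)} ∕ ∫e^{−(xᵀSx + P + Σ_k q_k(u_k ⬝ᵥ x)²)} ≤ e^{b}` with `b ≥ Σ_k q_k((2σ−h)⁻¹Σ_i (u_k)_i² + m_k²)` displayed `y`-uniformly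
# (row NE7b, node U5c; kernel junction — the `Fin n → ℝ` ∕ `Matrix` twin of the OWNER's `…ConvexTiltLCS`, without the integrability census)

Cell `pub-balaban`, sub-cell `t4`, spine estimate NE7b (`T4WeightBudget.RelWeightBound`; NOT PRINTED in [Bałaban 1983–89], NOT PROVED).
Crux-route work under `Spine/NE7b/` (FREEZE (0) crux-prover clause); NOTHING of Bałaban's named or asserted; no `Support` leaf; no
`def`; zero `sorry`.

WHY.  The OWNER's `…ConvexTiltLCS.locCondStability_of_convexCarrier_on_support` (p367320 ✓) runs the road's ONE residual `Prop`
`…LocalConditionalStability.LocCondStability` for the convexity-road carrier with data on `EuclideanSpace ℝ (Fin n)` and the three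
integrability binders `hZ ∕ h1 ∕ h2` of T-60a′ DISPLAYED per background.  The Gaussian share of the row (`…GaussianBlockDecoupling`,
`…GaussianFibrewiseDecoupling`, `…QuadFormSimDiag`, …) speaks `Fin n → ℝ` ∕ `Matrix` letters: a kept block `S₁₁`, its coercivity `σ`, a
semiconvex remainder `P` with a `dP`-letter of modulus `−h`.  `…ConvexTiltMomentPiFree.exp_moment_le_of_quadratic_add_pi` (leaf-04) is T-60a′
in exactly those letters with `hZ ∕ h1 ∕ h2` DISCHARGED and the convexity letter SUPPLIED from `(S, σ, P, dP, h)` (`λ = 2σ − h > 0`).  THIS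
FILE is the corresponding junction BY NAME: per pattern prefix `g` of a level `j < K` and background `y`, data `(S, P, dP, q, u)` on
`Fin (n j g) → ℝ` with `y`-UNIFORM moduli `σ j g`, `h j g` and budget `b j g`, the hypotheses asked ON THE SUPPORT OF THE TERM ⟹
`LocCondStability T S K μ ρ₀ M b` — the instance's census loses the three INTEGRABILITY binders `hZ ∕ h1 ∕ h2` (and continuity `hVc`)
and states convexity as STRUCTURE — `S` symmetric + `σ`-coercive, `P` differentiable with a first-order `dP`-letter of modulus `−h`,
`2σ − h > 0` — instead of a `gradient` inequality for the whole exponent: per background (11) asks `hVc hV hZ hq h1 h2 hb`, this file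
asks `hS hσ hPd hP hq hb` (+ `hgap` per `(j, g)`).

WHAT IS PROVED ([folklore]; plumbing over `exp_moment_le_of_quadratic_add_pi` and the gen-105 `locCondStability_of_carrier_le_on_support`):
`quadraticCarrier_nonneg`, `quadraticCarrier_le`, **`locCondStability_of_quadraticCarrier_pi_on_support`**.

NOT HERE (honest): WHICH `S, σ, P, h` Bałaban's small-field steps afford ((A3) ∕ Δ4 of the refuter's price map), the tilted means `m_k`
by value ((R1″)-class, inside the budget), anything of Bałaban's.  BY-NAME EFFECT ON THE WALL: NONE.  NE7b NOT PRINTED ∕ NOT PROVED; spine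
PROVED 0∕9; rung (B)+1 on a FINITE torus — NOT infinite volume, NOT the mass gap, NOT Clay.
HONEST DEPENDENCY: continuum YM on T⁴ ⇐ BetaPertH ∧ nine spine estimates (0/9 proved); BetaPertH ⇐ (D1) ∧ (D4) ∧ CAP+tail; G-an2-4
gates asym, D1 and NE2/3/4.
-/

set_option autoImplicit false

noncomputable section

open MeasureTheory Real Finset
open scoped Matrix
open Summit.QuantumFields.BalabanUV.T4Continuum.B16HistoryIndexedRepr Summit.QuantumFields.BalabanUV.T4Continuum.B16HistoryReprChain
open Summit.QuantumFields.BalabanUV.T4Continuum.NE7b.PrefixExtraction Summit.QuantumFields.BalabanUV.T4Continuum.NE7b.LocalConditionalStability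
open Summit.QuantumFields.BalabanUV.T4Continuum.NE7b.CarrierOnSupport
open Summit.QuantumFields.BalabanUV.T4Continuum.NE7b.ConvexTiltMomentPiFree

namespace Summit.QuantumFields.BalabanUV.T4Continuum.NE7b.ConvexTiltLCSPi

/-! ## §1 One background, product coordinates: the carrier `∫e^{−(xᵀSx+P)} ∕ ∫e^{−(xᵀSx+P+g)}` is non-negative and at most `e^{b}` -/

section OneBackground

variable {ι : Type*} [Fintype ι]

/-- The product-coordinate convexity-road carrier is non-negative. [folklore] -/
theorem quadraticCarrier_nonneg (S : Matrix ι ι ℝ) (P : (ι → ℝ) → ℝ) {r : ℕ} (q : Fin r → ℝ) (u : Fin r → ι → ℝ) :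
    0 ≤ (∫ x, exp (-(x ⬝ᵥ (S *ᵥ x) + P x))) / ∫ x, exp (-((x ⬝ᵥ (S *ᵥ x) + P x) + ∑ k, q k * (u k ⬝ᵥ x) ^ 2)) :=
  div_nonneg (integral_nonneg fun _ => (exp_pos _).le) (integral_nonneg fun _ => (exp_pos _).le)

/-- **THE PRODUCT-COORDINATE CARRIER OF ONE BACKGROUND IS AT MOST `e^{b}`**, data `(S, σ, P, dP, h; q, u)` only: `S` symmetric with
`σ·Σ_i v_i² ≤ vᵀSv`, `P` differentiable with the `dP`-letter of modulus `−h`, `2σ − h > 0`, `q ≥ 0`, and the budget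
`Σ_k q_k((2σ−h)⁻¹Σ_i (u_k)_i² + m_k²) ≤ b` (`m_k` the tilted means) — `…ConvexTiltMomentPiFree.exp_moment_le_of_quadratic_add_pi` divided
through; NO integrability binder. [folklore] -/
theorem quadraticCarrier_le {S : Matrix ι ι ℝ} (hS : S.IsSymm) {σ h b : ℝ}
    (hσ : ∀ v : ι → ℝ, σ * ∑ i, v i ^ 2 ≤ v ⬝ᵥ (S *ᵥ v)) {P : (ι → ℝ) → ℝ} (hPd : Differentiable ℝ P)
    {dP : (ι → ℝ) → (ι → ℝ)} (hP : ∀ x y : ι → ℝ, P x + dP x ⬝ᵥ (y - x) + (-h) / 2 * ∑ i, (y i - x i) ^ 2 ≤ P y)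
    (hgap : 0 < 2 * σ - h) {r : ℕ} (q : Fin r → ℝ) (hq : ∀ k, 0 ≤ q k) (u : Fin r → ι → ℝ)
    (hb : ∑ k, q k * ((2 * σ - h)⁻¹ * ∑ i, u k i ^ 2 +
        (∫ x, u k ⬝ᵥ x ∂(volume.tilted fun x : ι → ℝ => -(x ⬝ᵥ (S *ᵥ x) + P x))) ^ 2) ≤ b) :
    (∫ x, exp (-(x ⬝ᵥ (S *ᵥ x) + P x))) / (∫ x, exp (-((x ⬝ᵥ (S *ᵥ x) + P x) + ∑ k, q k * (u k ⬝ᵥ x) ^ 2))) ≤ exp b := by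
  refine div_le_of_le_mul₀ (integral_nonneg fun _ => (exp_pos _).le) (exp_pos _).le ?_
  exact (exp_moment_le_of_quadratic_add_pi hS hσ hPd hP hgap q hq u).trans
    (mul_le_mul_of_nonneg_right (exp_le_exp.2 hb) (integral_nonneg fun _ => (exp_pos _).le))

end OneBackground

/-! ## §2 The junction: `LocCondStability` by name for the product-coordinate carrier, from data displayed on the support -/

section Junction

variable {P : Type} [DecidableEq P] {C : ℕ → Type} {𝒢 : (j : ℕ) → GoodClass (C j)}

/-- **LCS FOR A BACKGROUND-DEPENDENT CONVEXITY-ROAD CARRIER IN PRODUCT COORDINATES, ON THE SUPPORT.**  At every pattern prefix `g` of a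
level `j < K` and every background `y` let `M j g y = (∫e^{−V}) ∕ (∫e^{−(V+g)})` on `Fin (n j g) → ℝ` with `V = xᵀ(S j g y)x + Pf j g y x`
and the sacrificed form `Σ_k q_k (u_k ⬝ᵥ x)²` (`r j g` terms); suppose `M j g` is a.e.-strongly measurable and ON THE SUPPORT OF THE TERM:
`S` symmetric and `σ j g`-coercive, `Pf` differentiable with a `dP`-letter of modulus `−h j g`, `2σ − h > 0` (both `y`-UNIFORM), and the
`y`-UNIFORM budget `Σ_k q_k((2σ−h)⁻¹Σ_i (u_k)_i² + m_k²) ≤ b j g`; weights `q ≥ 0`.  Then `LocCondStability T S K μ ρ₀ M b`, integrability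
conjunct included — with NO `hZ ∕ h1 ∕ h2` binder (discharged inside `…ConvexTiltMomentPiFree`). [folklore] -/
theorem locCondStability_of_quadraticCarrier_pi_on_support (T : Tower P C 𝒢) (Spat : (j : ℕ) → (Fin j → P) → Finset P)
    (K : ℕ) [∀ j, MeasurableSpace (C j)] (μ : (j : ℕ) → Measure (C j)) (ρ₀ : C 0 → ℝ)
    (M : (j : ℕ) → (Fin j → P) → C j → ℝ)
    (n r : (j : ℕ) → (Fin j → P) → ℕ)
    (S : (j : ℕ) → (g : Fin j → P) → C j → Matrix (Fin (n j g)) (Fin (n j g)) ℝ)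
    (Pf : (j : ℕ) → (g : Fin j → P) → C j → (Fin (n j g) → ℝ) → ℝ)
    (dP : (j : ℕ) → (g : Fin j → P) → C j → (Fin (n j g) → ℝ) → (Fin (n j g) → ℝ))
    (q : (j : ℕ) → (g : Fin j → P) → C j → Fin (r j g) → ℝ)
    (u : (j : ℕ) → (g : Fin j → P) → C j → Fin (r j g) → Fin (n j g) → ℝ)
    (σ h b : (j : ℕ) → (Fin j → P) → ℝ) (hρ : (𝒢 0).Gd ρ₀) (h0 : ∀ x, 0 ≤ ρ₀ x)
    (hM : ∀ j g, j < K → g ∈ admS T Spat j → ∀ y, M j g y =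
      (∫ x, exp (-(x ⬝ᵥ (S j g y *ᵥ x) + Pf j g y x))) /
        ∫ x, exp (-((x ⬝ᵥ (S j g y *ᵥ x) + Pf j g y x) + ∑ k, q j g y k * (u j g y k ⬝ᵥ x) ^ 2)))
    (hMm : ∀ j g, j < K → g ∈ admS T Spat j → AEStronglyMeasurable (M j g) (μ j))
    (hS : ∀ j g, j < K → g ∈ admS T Spat j → ∀ y, T.eterm ρ₀ j g y ≠ 0 → (S j g y).IsSymm)
    (hσ : ∀ j g, j < K → g ∈ admS T Spat j → ∀ y, T.eterm ρ₀ j g y ≠ 0 →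
      ∀ v : Fin (n j g) → ℝ, σ j g * ∑ i, v i ^ 2 ≤ v ⬝ᵥ (S j g y *ᵥ v))
    (hPd : ∀ j g, j < K → g ∈ admS T Spat j → ∀ y, T.eterm ρ₀ j g y ≠ 0 → Differentiable ℝ (Pf j g y))
    (hP : ∀ j g, j < K → g ∈ admS T Spat j → ∀ y, T.eterm ρ₀ j g y ≠ 0 → ∀ x z : Fin (n j g) → ℝ,
      Pf j g y x + dP j g y x ⬝ᵥ (z - x) + (-h j g) / 2 * ∑ i, (z i - x i) ^ 2 ≤ Pf j g y z)
    (hgap : ∀ j g, j < K → g ∈ admS T Spat j → 0 < 2 * σ j g - h j g)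
    (hq : ∀ j g, j < K → g ∈ admS T Spat j → ∀ y, T.eterm ρ₀ j g y ≠ 0 → ∀ k, 0 ≤ q j g y k)
    (hb : ∀ j g, j < K → g ∈ admS T Spat j → ∀ y, T.eterm ρ₀ j g y ≠ 0 →
      ∑ k, q j g y k * ((2 * σ j g - h j g)⁻¹ * ∑ i, u j g y k i ^ 2 +
        (∫ x, u j g y k ⬝ᵥ x ∂(volume.tilted fun x : Fin (n j g) → ℝ => -(x ⬝ᵥ (S j g y *ᵥ x) + Pf j g y x))) ^ 2) ≤ b j g)
    (hint : ∀ j g, j < K → g ∈ admS T Spat j → Integrable (T.eterm ρ₀ j g) (μ j)) :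
    LocCondStability T Spat K μ ρ₀ M b := by
  refine locCondStability_of_carrier_le_on_support T Spat K μ ρ₀ M _ hρ h0 hMm (fun j g hj hg y => ?_)
    (fun j g hj hg y hy => ?_) hint
  · rw [hM j g hj hg y]
    exact quadraticCarrier_nonneg _ _ _ _
  · rw [hM j g hj hg y]
    exact quadraticCarrier_le (hS j g hj hg y hy) (hσ j g hj hg y hy) (hPd j g hj hg y hy) (hP j g hj hg y hy) (hgap j g hj hg)
      _ (hq j g hj hg y hy) _ (hb j g hj hg y hy)

end Junction

end Summit.QuantumFields.BalabanUV.T4Continuum.NE7b.ConvexTiltLCSPi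

end
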